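import Summits.HodgeConjecture.HodgeConjecture.Theorems.PadicSemiregularLiftFormalVectorBundlesAlgebraizeUnitFree
import Literature.AlgebraicGeometry.Modules.SheafHomExact
import Literature.AlgebraicGeometry.Modules.LocalFrames

/-!
# `𝓗om(V', V)` of finite locally free modules is finite locally free

Helper file for stub `stub_presentationAlgebraize` (EB2) of line `chow-zariski-pushforward` of the
crux `PadicSemiregularLift.FormalVectorBundlesAlgebraize` (`stmt-HodgeConjecture-14106`): the stub
applies the module Bockstein hypothesis to the vector bundle `M = 𝓗om(V', V)` (tree
`Literature.AlgebraicGeometry.Modules.sheafHom`), which requires `M` to be finite locally free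
(`Literature.AlgebraicGeometry.Motives.IsFiniteLocallyFree`, hence a vector bundle by the tree's
`IsFiniteLocallyFree.isVectorBundle`).

* `nonempty_free_iso_sheafHom_over` — on an open `W` with frames `𝒪^{I'} ≅ V'|_W`, `𝒪^I ≅ V|_W`
  (`I'`, `I` finite), the morphism `𝒪^{I' × I} ⟶ 𝓗om(V', V)|_W` defined by the matrix units
  `E_{i'i} : b'_{j'} ↦ [j' = i'] b_i` (tree `homOfBasisValues`) is an isomorphism: on sections over an
  open `Y` over `W` it is bijective, by expanding morphisms `V'|_Y ⟶ V|_Y` in the restricted frames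
  (tree `LocalFrames`: `coord`, `eq_sum_coord_smul`, `hom_ext_of_basisSection`) and sections of
  `𝒪^{I' × I}` in the tautological basis (`free_sections_basis` of `…AlgebraizeUnitFree`);
* `isFiniteLocallyFree_sheafHom` — hence `𝓗om(V', V)` is finite locally free.

Everything is proved; no definitions (the matrix units are a local notation).
-/

set_option linter.dupNamespace false
set_option backward.isDefEq.respectTransparency false

noncomputable section

-- Summit.HodgeConjecture.HodgeConjecture.… repeats the summit name by the D-0017 layout (Sub = Summit).

open CategoryTheory CategoryTheory.Limits

universe v₁ u₁ u

namespace Summit.HodgeConjecture.HodgeConjecture.Theorems.FormalVectorBundlesAlgebraize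

open scoped Classical

/-- The tautological basis sections `b_i ∈ Γ(c, 𝒪^I)` of the free module. -/
local notation3 (prettyPrint := false) "𝔟[" R' ", " i ", " c "]" =>
  (SheafOfModules.ιFree (R := R') i).val.app c (1 : (ObjectProperty.FullSubcategory.obj R').obj c)

/-! ### Matrix units: `𝓗om(V', V)|_W ≅ 𝒪^{I' × I}` on a common trivialising open -/

section SheafHomFree

open AlgebraicGeometry TopologicalSpace Opposite Literature.AlgebraicGeometry.Modules
  Literature.AlgebraicGeometry.Motives

variable {X : Scheme.{u}} {V' V : X.Modules} {W : X.Opens} {I' I : Type u}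
  (e' : SheafOfModules.free I' ≅ V'.over W) (e : SheafOfModules.free I ≅ V.over W)

/-- The matrix units `E_{i'i} : V'|_W ⟶ V|_W` (`b'_{j'} ↦ [j' = i'] b_i`) of two frames. -/
local notation3 (prettyPrint := false) "𝔈[" e' ", " e ", " i' ", " i "]" =>
  homOfBasisValues e' fun j' => if j' = i' then basisSection e i else 0

/-- Values of the matrix units on the basis sections, after restriction to an open `Y` over `W`. -/
theorem appLE_restrictHom_matrixUnit (Y : Over W) (i' j' : I') (i : I) :
    appLE (restrictHom Y.hom 𝔈[e', e, i', i]) (𝟙 Y.left)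
        (basisSection (SheafOfModules.restrictTrivialisation (R := X.ringCatSheaf) Y.hom e') j') =
      if j' = i' then basisSection (SheafOfModules.restrictTrivialisation (R := X.ringCatSheaf) Y.hom e) i
        else 0 := by
  rw [appLE_restrictHom, basisSection_restrictTrivialisation, Category.id_comp,
    appLE_congr_hom _ Y.hom (Y.hom ≫ 𝟙 W), appLE_map, appLE_homOfBasisValues]
  split_ifs
  · rw [basisSection_restrictTrivialisation]
  · exact map_zero _

variable [Fintype I'] [Fintype I]

/-- A combination `∑ a_{i'i} E_{i'i}|_Y` evaluated on the basis section `b'_{j'}|_Y` is `∑_i a_{j'i} b_i|_Y`. -/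
theorem appLE_sum_smul_matrixUnit (Y : Over W) (a : I' × I → Γ(X, Y.left)) (j' : I') :
    appLE (∑ ii : I' × I, a ii • restrictHom Y.hom 𝔈[e', e, ii.1, ii.2]) (𝟙 Y.left)
        (basisSection (SheafOfModules.restrictTrivialisation (R := X.ringCatSheaf) Y.hom e') j') =
      ∑ i, a (j', i) •
        basisSection (SheafOfModules.restrictTrivialisation (R := X.ringCatSheaf) Y.hom e) i := by
  classical
  rw [appLE_sum, Fintype.sum_prod_type]
  have h : ∀ i' i, appLE (a (i', i) • restrictHom Y.hom 𝔈[e', e, i', i]) (𝟙 Y.left)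
      (basisSection (SheafOfModules.restrictTrivialisation (R := X.ringCatSheaf) Y.hom e') j') =
      if i' = j' then a (j', i) •
        basisSection (SheafOfModules.restrictTrivialisation (R := X.ringCatSheaf) Y.hom e) i else 0 := by
    intro i' i
    rw [appLE_smul_id, appLE_restrictHom_matrixUnit]
    split_ifs with h1 h2 h2
    · subst h1; rfl
    · exact absurd h1.symm h2
    · exact absurd h2.symm h1
    · exact smul_zero _
  simp_rw [h]
  rw [Finset.sum_comm]
  simp_rw [Finset.sum_ite_eq', Finset.mem_univ, if_true]

/-- Coordinates of a combination of basis sections. -/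
theorem coord_sum_smul_basisSection {E : X.Modules} {U : X.Opens} {J : Type u} [Fintype J]
    (f : SheafOfModules.free J ≅ E.over U) (a : J → Γ(X, U)) (j : J) :
    coord f (𝟙 U) (∑ i, a i • basisSection f i) j = a j := by
  classical
  rw [coord_def, appLE_sum_right]
  have h : ∀ i, appLE (dualBasis f j) (𝟙 U) (a i • basisSection f i) = if i = j then a j else 0 := by
    intro i
    rw [appLE_smul_right, ← coord_def, coord_basisSection]
    split_ifs with hij
    · rw [hij]
      change a j * 1 = a j
      exact mul_one _
    · exact smul_zero _
  simp_rw [h, Finset.sum_ite_eq', Finset.mem_univ, if_true]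

omit [Fintype I'] [Fintype I] in
/-- `(𝒪 ⟶ M)` picking a section `s`: its value on `1` is `s`. -/
theorem unitHomEquiv_symm_val_app_one {C : Type u₁} [Category.{v₁} C] {J : GrothendieckTopology C}
    {R : Sheaf J RingCat.{u}} [HasWeakSheafify J AddCommGrpCat.{u}]
    [J.WEqualsLocallyBijective AddCommGrpCat.{u}] {M : SheafOfModules.{u} R} (s : M.sections)
    (c : Cᵒᵖ) : (M.unitHomEquiv.symm s).val.app c (1 : R.obj.obj c) = s.val c := by
  have h := SheafOfModules.unitHomEquiv_apply_coe M (M.unitHomEquiv.symm s) c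
  rw [Equiv.apply_symm_apply] at h
  exact h.symm

include e' e in
/-- **`𝓗om(V', V)|_W ≅ 𝒪^{I' × I}`** on an open `W` on which `V'` and `V` are free: the morphism
`𝒪^{I' × I} ⟶ 𝓗om(V', V)|_W` defined by the matrix units is an isomorphism (bijective on sections over
every open `Y` over `W`, by expanding in the restricted frames). -/
theorem nonempty_free_iso_sheafHom_over :
    Nonempty (SheafOfModules.free (I' × I) ≅ (sheafHom V' V).over W) := by
  classical
  -- the morphism defined by the matrix units
  let σ : I' × I → ((sheafHom V' V).over W).sections := fun ii =>
    (Scheme.Modules.overSectionsEquiv (sheafHom V' V) W).symm (𝔈[e', e, ii.1, ii.2] :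
      Γ(sheafHom V' V, W))
  let μ : SheafOfModules.free (I' × I) ⟶ (sheafHom V' V).over W :=
    ((sheafHom V' V).over W).freeHomEquiv.symm σ
  -- its values on the tautological basis sections: the restricted matrix units
  have hμb : ∀ (Y : (Over W)ᵒᵖ) (ii : I' × I),
      (μ.val.app Y 𝔟[X.ringCatSheaf.over W, ii, Y] : V'.over Y.unop.left ⟶ V.over Y.unop.left) =
        restrictHom Y.unop.hom 𝔈[e', e, ii.1, ii.2] := by
    intro Y ii
    change (SheafOfModules.ιFree ii ≫ μ).val.app Y (1 : Γ(X, Y.unop.left)) = _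
    rw [← SheafOfModules.unitHomEquiv_symm_freeHomEquiv_apply, Equiv.apply_symm_apply,
      unitHomEquiv_symm_val_app_one]
    rfl
  -- bijectivity on sections over `Y`
  have hbij : ∀ Y : (Over W)ᵒᵖ, Function.Bijective (μ.val.app Y) := by
    intro Y
    obtain ⟨l₀, -, hgen₀, hcoord₀⟩ :=
      free_sections_basis (R := X.ringCatSheaf.over W) (I := I' × I) Y
    -- retype the coordinate functionals over `Γ(X, Y.left)`
    let l : I' × I → ((SheafOfModules.free (R := X.ringCatSheaf.over W) (I' × I)).val.obj Y →ₗ[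
        Γ(X, Y.unop.left)] Γ(X, Y.unop.left)) := l₀
    have hgen : ∀ t, t = ∑ ii, l ii t • 𝔟[X.ringCatSheaf.over W, ii, Y] := hgen₀
    have hcoord : ∀ (a : I' × I → Γ(X, Y.unop.left)) (ii : I' × I),
        l ii (∑ jj, a jj • 𝔟[X.ringCatSheaf.over W, jj, Y]) = a ii := hcoord₀
    let eY' := SheafOfModules.restrictTrivialisation (R := X.ringCatSheaf) Y.unop.hom e'
    let eY := SheafOfModules.restrictTrivialisation (R := X.ringCatSheaf) Y.unop.hom e
    -- values of `μ` on a general section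
    have hμ : ∀ t, (μ.val.app Y t : V'.over Y.unop.left ⟶ V.over Y.unop.left) =
        ∑ ii, l ii t • restrictHom Y.unop.hom 𝔈[e', e, ii.1, ii.2] := by
      intro t
      conv_lhs => rw [hgen t]
      rw [map_sum]
      refine Finset.sum_congr rfl fun ii _ => ?_
      rw [map_smul]
      exact congrArg (fun v : V'.over Y.unop.left ⟶ V.over Y.unop.left => l ii t • v) (hμb Y ii)
    -- the coordinates of `μ t` in the frames over `Y`
    have hc : ∀ t j' i, coord eY (𝟙 _) (appLE (μ.val.app Y t : V'.over Y.unop.left ⟶ V.over Y.unop.left)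
        (𝟙 _) (basisSection eY' j')) i = l (j', i) t := by
      intro t j' i
      rw [hμ, appLE_sum_smul_matrixUnit, coord_sum_smul_basisSection]
    constructor
    · -- injective
      intro t₁ t₂ h
      rw [← sub_eq_zero] at h ⊢
      rw [← map_sub] at h
      have hzero : ∀ ii : I' × I, l ii (t₁ - t₂) = 0 := by
        rintro ⟨j', i⟩
        rw [← hc, h, appLE_zero, coord_def, appLE_zero_right]
      rw [hgen (t₁ - t₂)]
      exact Finset.sum_eq_zero fun ii _ => by rw [hzero, zero_smul]
    · -- surjective
      intro χ
      let c : I' × I → Γ(X, Y.unop.left) := fun ii =>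
        coord eY (𝟙 _) (appLE (χ : V'.over Y.unop.left ⟶ V.over Y.unop.left) (𝟙 _)
          (basisSection eY' ii.1)) ii.2
      refine ⟨∑ ii, c ii • 𝔟[X.ringCatSheaf.over W, ii, Y], ?_⟩
      rw [hμ]
      simp_rw [hcoord]
      refine hom_ext_of_basisSection eY' fun j' => ?_
      rw [appLE_sum_smul_matrixUnit]
      conv_rhs => rw [eq_sum_coord_smul eY (𝟙 _)
        (appLE (χ : V'.over Y.unop.left ⟶ V.over Y.unop.left) (𝟙 _) (basisSection eY' j'))]
      exact Finset.sum_congr rfl fun i _ => by rw [presheaf_map_id]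
  haveI : ∀ Y, IsIso (μ.val.app Y) := fun Y =>
    (ConcreteCategory.isIso_iff_bijective _).mpr (hbij Y)
  let e₀ : (SheafOfModules.free (R := X.ringCatSheaf.over W) (I' × I)).val ≅
      ((sheafHom V' V).over W).val :=
    PresheafOfModules.isoMk (fun Y => asIso (μ.val.app Y)) (fun Y Y' g => μ.val.naturality g)
  exact ⟨(SheafOfModules.fullyFaithfulForget _).preimageIso e₀⟩

/-- **`𝓗om(V', V)` is finite locally free for `V'`, `V` finite locally free** (locally
`𝓗om(𝒪^{I'}, 𝒪^I) ≅ 𝒪^{I' × I}` by matrix units). -/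
theorem isFiniteLocallyFree_sheafHom {V' V : X.Modules} (hV' : IsFiniteLocallyFree V')
    (hV : IsFiniteLocallyFree V) : IsFiniteLocallyFree (sheafHom V' V) := by
  intro x
  obtain ⟨U', hxU', I', hI', ⟨e'⟩⟩ := hV' x
  obtain ⟨U, hxU, I, hI, ⟨e⟩⟩ := hV x
  haveI := Fintype.ofFinite I'
  haveI := Fintype.ofFinite I
  refine ⟨U' ⊓ U, ⟨hxU', hxU⟩, I' × I, inferInstance,
    nonempty_free_iso_sheafHom_over
      (SheafOfModules.restrictTrivialisation (R := X.ringCatSheaf) (homOfLE inf_le_left) e')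
      (SheafOfModules.restrictTrivialisation (R := X.ringCatSheaf) (homOfLE inf_le_right) e)⟩

end SheafHomFree

/-- **Registered sub-goal** (helper stub of `stub_presentationAlgebraize`, universe `0`): `𝓗om(V', V)` of
finite locally free modules is finite locally free (`isFiniteLocallyFree_sheafHom`). -/
theorem stub_sheafHomFiniteLocallyFree :
    ∀ (X : AlgebraicGeometry.Scheme.{0}) (V' V : X.Modules), Literature.AlgebraicGeometry.Motives.IsFiniteLocallyFree V' → Literature.AlgebraicGeometry.Motives.IsFiniteLocallyFree V → Literature.AlgebraicGeometry.Motives.IsFiniteLocallyFree (Literature.AlgebraicGeometry.Modules.sheafHom V' V) :=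
  fun _ _ _ hV' hV => isFiniteLocallyFree_sheafHom hV' hV

end Summit.HodgeConjecture.HodgeConjecture.Theorems.FormalVectorBundlesAlgebraize

end
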